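import Mathlib
import Literature.AlgebraicGeometry.Resolution.CobordantChartCoefficients

/-!
# Hironaka's characteristic polyhedron with ONE free variable (the axis case)

Folklore infrastructure for the crux `LocalWeightedDrop` of route ResolutionOfSingularities/WeightedInvariant
(item stmt-ResolutionOfSingularities-8899), line `hasse-ridge-face-selection`: the case of a formal hypersurface germ
`g ∈ k[[x₁, …, x_n, z]]` of order `d` whose tangent cone `in_d g = F(x')` does not involve the last variable `z` and has
trivial apex as a form in `x'` (the directrix of `g` is the `z`-AXIS, `dim = 1`).  Hironaka's characteristic polyhedron
`Δ(g; x'; z)` (Hironaka, *Characteristic polyhedra of singularities*, J. Math. Kyoto Univ. 7 (1967); Cossart–Jannsen–Saito,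
LNM 2270, Ch. 7–8; Cossart–Piltant 2008 §2) then lives in `ℝ¹`: it is the half-line `[δ, ∞)` with
`δ(g; x'; z) = min { c / (d - |a|) : |a| < d, g_{a,c} ≠ 0 }` over the monomials `x'^a z^c` of `g`, and its single vertex `δ` is
SOLVABLE iff `δ ∈ ℕ` and the `δ`-initial form is `F(X' + λ Z^δ)` for some `λ ∈ kⁿ`, in which case the shear `x' ↦ x' - λ z^δ`
dissolves it (Hironaka's vertex preparation; with one free variable there is no "kangaroo": prepared stays prepared under the
blow-ups of the game).

This file records the coefficient-level vocabulary (no theorem beyond unfolding):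
* `xDeg E` — the `x'`-degree `|a|` of an exponent `E = (a, c)`; `AxisCone d g` — the degree-`d` part of `g` involves no `z`;
  `TrivialApexX d g` — the degree-`d` form has no non-zero translation-invariance vector inside `z = 0`
  (`CobordantChart.initEval` with all weights `1` is the evaluation of the degree-`d` part);
* `InAxisIdeal d g` — `g ∈ (x')^d` (no monomial of `x'`-degree `< d`; `δ = ∞`: `g` is equimultiple along the axis);
  `AboveLevel d r q g` — `δ(g; x'; z) ≥ r/q` (every monomial `x'^a z^c` with `|a| < d` has `q·c ≥ r·(d - |a|)`);
* `taylorCoeff d g lam E` — the coefficient of `X'^a Z^{M(d-|a|)}` in `F(X' + lam · Z^M)` for `E = (a, M(d-|a|))`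
  (Hasse–Taylor expansion of the degree-`d` form `F` of `g`; it does not depend on `M`);
  `Solvable d M lam g` — `δ ≥ M` and the level-`M` vertex coefficients of `g` are those of `F(X' + lam Z^M)`;
  `PreparedAxis d g` — no NON-ZERO solving vector at any integer level (at the level `M = δ(g)` this is Hironaka's
  "vertex not solvable"; at the other levels it holds automatically when the apex is trivial);
* `IsZOnly ψ` — a series in `z` alone; `shearFam ψ` — the shear `x'_j ↦ x'_j - ψ_j(z)`, `z ↦ z`.

Design: plain coefficient-level definitions over a field `k : Type`, exponents of `Fin (n + 1)` with `z = Fin.last n` and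
`x'_j = Fin.castSucc j`, matching `CobordantTupleGame` / `CobordantGame`.  Junk values, documented: `d - xDeg E` is only used
under `xDeg E < d`; `taylorCoeff` is a `finsum` (finite support: exponents of degree `d`).  Deliberately NOT here: the
preparation theorem (finite-or-convergent vertex dissolution), the transformation laws under the weighted moves of the game,
and anything about polyhedra with `≥ 2` free variables.
-/

namespace Literature.AlgebraicGeometry.Resolution.AxisPolyhedron

open MvPowerSeries

variable {k : Type} [Field k] {n : ℕ}

/-- The `x'`-DEGREE `|a|` of an exponent `E = (a, c)` of `k[[x'₁..x'_n, z]]` (`z = Fin.last n`). [folklore] -/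
def xDeg (E : Fin (n + 1) →₀ ℕ) : ℕ := ∑ j : Fin n, E (Fin.castSucc j)

/-- AXIS CONE: the degree-`d` part of `g` involves no `z` — every exponent of total degree `d` with a positive `z`-component
has zero coefficient (so `in_d g = F(x')`). [folklore] -/
def AxisCone (d : ℕ) (g : MvPowerSeries (Fin (n + 1)) k) : Prop :=
  ∀ E : Fin (n + 1) →₀ ℕ, E.degree = d → E (Fin.last n) ≠ 0 → MvPowerSeries.coeff E g = 0

/-- TRIVIAL APEX INSIDE `z = 0`: no non-zero vector `(u, 0)` leaves the degree-`d` form of `g` translation-invariant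
(tested on the hyperplane `z = 0`, where the form lives when `AxisCone` holds): the directrix of `g` is exactly the `z`-axis.
[folklore] -/
def TrivialApexX (d : ℕ) (g : MvPowerSeries (Fin (n + 1)) k) : Prop :=
  ∀ u : Fin n → k, u ≠ 0 → ∃ v : Fin n → k,
    CobordantChart.initEval (fun _ : Fin (n + 1) => 1) ((Fin.snoc v 0 : Fin (n + 1) → k) + Fin.snoc u 0) d g ≠
      CobordantChart.initEval (fun _ : Fin (n + 1) => 1) (Fin.snoc v 0 : Fin (n + 1) → k) d g

/-- `g ∈ (x')^d`: no monomial of `x'`-degree `< d` (`δ(g; x'; z) = ∞`; `g` is equimultiple along the `z`-axis). [folklore] -/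
def InAxisIdeal (d : ℕ) (g : MvPowerSeries (Fin (n + 1)) k) : Prop :=
  ∀ E : Fin (n + 1) →₀ ℕ, xDeg E < d → MvPowerSeries.coeff E g = 0

/-- `δ(g; x'; z) ≥ r / q`: every monomial `x'^a z^c` of `g` with `|a| < d` satisfies `q · c ≥ r · (d - |a|)` (Hironaka's
`δ`-invariant of the polyhedron `Δ(g; x'; z) ⊂ ℝ`, compared with a rational level). [folklore] -/
def AboveLevel (d r q : ℕ) (g : MvPowerSeries (Fin (n + 1)) k) : Prop :=
  ∀ E : Fin (n + 1) →₀ ℕ, xDeg E < d → q * E (Fin.last n) < r * (d - xDeg E) → MvPowerSeries.coeff E g = 0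

open scoped Classical in
/-- The HASSE–TAYLOR COEFFICIENT: for an exponent `E = (a, ·)`, the coefficient of `X'^a` in the expansion of `F(X' + lam)`
truncated to the monomials `B = (b, 0)`, `|b| = d`, `b ≥ a` of the degree-`d` form `F` of `g`:
`Σ_b F_b · Π_j C(b_j, a_j) · lam_j^{b_j - a_j}` — the coefficient of `X'^a Z^{M(d-|a|)}` in `F(X' + lam Z^M)` for every
`M`. [folklore] -/
noncomputable def taylorCoeff (d : ℕ) (g : MvPowerSeries (Fin (n + 1)) k) (lam : Fin n → k)
    (E : Fin (n + 1) →₀ ℕ) : k :=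
  ∑ᶠ B : Fin (n + 1) →₀ ℕ,
    if B.degree = d ∧ B (Fin.last n) = 0 ∧ (∀ j : Fin n, E (Fin.castSucc j) ≤ B (Fin.castSucc j)) then
      MvPowerSeries.coeff B g *
        ∏ j : Fin n, ((Nat.choose (B (Fin.castSucc j)) (E (Fin.castSucc j)) : k) *
          lam j ^ (B (Fin.castSucc j) - E (Fin.castSucc j)))
    else 0

/-- The vertex at the integer level `M` is SOLVED BY `lam`: `δ(g; x'; z) ≥ M` and every coefficient of `g` on the line
`c = M (d - |a|)`, `|a| < d`, equals the corresponding coefficient of `F(X' + lam Z^M)` (Hironaka's solvable vertex; the shear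
`x' ↦ x' - lam z^M` then raises `δ`). [folklore] -/
def Solvable (d M : ℕ) (lam : Fin n → k) (g : MvPowerSeries (Fin (n + 1)) k) : Prop :=
  AboveLevel d M 1 g ∧
    ∀ E : Fin (n + 1) →₀ ℕ, xDeg E < d → E (Fin.last n) = M * (d - xDeg E) →
      MvPowerSeries.coeff E g = taylorCoeff d g lam E

/-- PREPARED ALONG THE AXIS: no NON-ZERO vector solves the vertex at any integer level.  At the level `M = δ(g; x'; z)`
(when integral) this is Hironaka's "vertex not solvable"; at the other levels it is automatic for a cone with trivial apex
inside `z = 0`. [folklore] -/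
def PreparedAxis (d : ℕ) (g : MvPowerSeries (Fin (n + 1)) k) : Prop :=
  ∀ (M : ℕ) (lam : Fin n → k), lam ≠ 0 → ¬ Solvable d M lam g

/-- A series in the free variable `z` alone. [folklore] -/
def IsZOnly (ψ : MvPowerSeries (Fin (n + 1)) k) : Prop :=
  ∀ E : Fin (n + 1) →₀ ℕ, MvPowerSeries.coeff E ψ ≠ 0 → xDeg E = 0

/-- The SHEAR along the axis by `ψ = (ψ_j(z))_j`: `x'_j ↦ x'_j - ψ_j`, `z ↦ z` (Hironaka's vertex dissolution when
`ψ_j = lam_j z^M`; their `z`-adic limits). [folklore] -/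
noncomputable def shearFam (ψ : Fin n → MvPowerSeries (Fin (n + 1)) k) : Fin (n + 1) → MvPowerSeries (Fin (n + 1)) k :=
  fun l => Fin.lastCases (X (Fin.last n)) (fun j => X (Fin.castSucc j) - ψ j) l

/-- Value of the shear family at the free variable. [folklore] -/
@[simp] theorem shearFam_last (ψ : Fin n → MvPowerSeries (Fin (n + 1)) k) :
    shearFam ψ (Fin.last n) = X (Fin.last n) := by
  simp [shearFam]

/-- Value of the shear family at an axis variable. [folklore] -/
@[simp] theorem shearFam_castSucc (ψ : Fin n → MvPowerSeries (Fin (n + 1)) k) (j : Fin n) :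
    shearFam ψ (Fin.castSucc j) = X (Fin.castSucc j) - ψ j := by
  simp [shearFam]

end Literature.AlgebraicGeometry.Resolution.AxisPolyhedron
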